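import Mathlib

/-!
# Wannier-gauge invariants of the two-body integrals: the density–density and exchange SUMS do not
# depend on the orbital gauge; what the on-site `U` gains under localisation, the inter-site `V` loses

The static interaction of a downfolded model is a four-index object in a chosen orthonormal (Wannier)
basis `{wᵢ}` of the target subspace, `U_{ijkl} = ⟨wᵢ wⱼ| W |w_k w_l⟩`.  Individual entries — in
particular the on-site `Uᵢ = U_{iiii}` and the inter-site density–density `V_{ij} = U_{ijij}` —
depend on the unitary GAUGE `wᵢ ↦ Σⱼ wⱼ V_{ji}` of the subspace (maximal localisation is one
choice; «such Wannier functions … maximise U» [MiyakeAryasetiawan2008, §IV: Edmiston–Ruedenberg's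
functional applied to solids]).  Two sums do NOT: the total density–density sum `Σ_{ij} U_{ijij}`
and the total exchange sum `Σ_{ij} U_{ijji}` are functionals of the subspace density matrix
`P = A Aᴴ` alone («the sum of coulomb operators is invariant to a unitary transformation of the
spin orbitals … In an identical manner … the sum of exchange operators» [SzaboOstlund1996, §3.2.3
Eqs. (3.61)–(3.64)]; the Edmiston–Ruedenberg localisation criterion rests on exactly this
[EdmistonRuedenberg1963]).  Hence (`onsite_add_offsite_gauge`): a gauge change that RAISES the sum
of on-site `Uᵢ` by `δ` LOWERS the sum of inter-site `V_{ij}` by the same `δ` — the exact content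
behind «localisation moves interaction weight between U and V at fixed sum», relevant when a box
compares on-site `U` values obtained with different Wannier spreads, or uses `U⋆ = U − V̄`.

Finite setting (everything PROVED, no facts): a finite grid `X` (points `r`), orbital labels `I`,
orbitals as the columns of `A : Matrix X I ℂ` (`A r i = wᵢ(r)`), a two-point kernel
`W : Matrix X X ℂ` (no symmetry or sign assumed), and
`twoBody A W i j k l = Σ_{r r'} conj(A r i) conj(A r' j) W r r' A r k A r' l`.  Orthonormality of
the columns is NOT needed for the invariance statements — only `V Vᴴ = 1`.  Not here: the
continuum/lattice-periodic versions (per-cell `U + Σ_{R≠0} V(R)` follows by translation symmetry),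
frequency dependence, the cRPA construction of `W`.

References: A. Szabo, N. S. Ostlund, *Modern Quantum Chemistry* (Dover 1996) §3.2.3 ·
C. Edmiston, K. Ruedenberg, Rev. Mod. Phys. 35 (1963) 457 · T. Miyake, F. Aryasetiawan,
Phys. Rev. B 77 (2008) 085122, §IV.  AI-produced formalisation (H21, cell hubbard-downfold, seat
lit-1, 2026-08-27).
-/

noncomputable section

open scoped BigOperators

namespace Literature.MathematicalPhysics.QuantumLattice

namespace WannierGauge

open Matrix

variable {X I : Type*} [Fintype I] [DecidableEq I]

/-- Subspace (one-body) density matrix of the orbital set `A`: `P = A Aᴴ`, `P r r' = Σᵢ wᵢ(r) conj wᵢ(r')`.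
[cite: SzaboOstlund1996, §3.2.3 Eq. (3.63) (the sum Σ_b χ_b^* χ_b)] -/
def densityMatrix (A : Matrix X I ℂ) : Matrix X X ℂ := A * Aᴴ

/-- The density matrix is gauge-invariant: `(A V)(A V)ᴴ = A Aᴴ` for `V Vᴴ = 1`.
[cite: SzaboOstlund1996, §3.2.3 Eq. (3.62)–(3.63)] -/
theorem densityMatrix_mul_of_unitary (A : Matrix X I ℂ) {V : Matrix I I ℂ} (hV : V * Vᴴ = 1) :
    densityMatrix (A * V) = densityMatrix A := by
  unfold densityMatrix
  rw [conjTranspose_mul, Matrix.mul_assoc, ← Matrix.mul_assoc V, hV, Matrix.one_mul]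

omit [DecidableEq I] in
/-- Diagonal of the density matrix: `P r r = Σᵢ wᵢ(r) conj wᵢ(r)`. [cite: SzaboOstlund1996, §3.2.3
Eq. (3.63)] -/
theorem densityMatrix_apply (A : Matrix X I ℂ) (r r' : X) :
    densityMatrix A r r' = ∑ i, A r i * star (A r' i) := by
  simp [densityMatrix, Matrix.mul_apply, conjTranspose_apply]

variable [Fintype X]

omit [DecidableEq I] in
/-- Reordering of a quadruple finite sum (orbital labels outside ↔ grid points outside). [folklore] -/
private theorem sum4_comm (F : I → I → X → X → ℂ) :
    ∑ i, ∑ j, ∑ r, ∑ r', F i j r r' = ∑ r, ∑ r', ∑ i, ∑ j, F i j r r' := by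
  calc ∑ i, ∑ j, ∑ r, ∑ r', F i j r r' = ∑ i, ∑ r, ∑ j, ∑ r', F i j r r' := by
        refine Finset.sum_congr rfl fun i _ => ?_
        exact Finset.sum_comm
    _ = ∑ r, ∑ i, ∑ j, ∑ r', F i j r r' := Finset.sum_comm
    _ = ∑ r, ∑ i, ∑ r', ∑ j, F i j r r' := by
        refine Finset.sum_congr rfl fun r _ => Finset.sum_congr rfl fun i _ => ?_
        exact Finset.sum_comm
    _ = ∑ r, ∑ r', ∑ i, ∑ j, F i j r r' := by
        refine Finset.sum_congr rfl fun r _ => ?_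
        exact Finset.sum_comm

/-- Two-body integral in the orbital basis, `⟨i j| W |k l⟩ = Σ_{r r'} conj wᵢ(r) conj wⱼ(r') W(r,r') w_k(r) w_l(r')`.
[cite: MiyakeAryasetiawan2008, §IV Eq. (U) (matrix elements in the Wannier basis)] -/
def twoBody (A : Matrix X I ℂ) (W : Matrix X X ℂ) (i j k l : I) : ℂ :=
  ∑ r, ∑ r', star (A r i) * star (A r' j) * W r r' * A r k * A r' l

/-- Total density–density ("Coulomb") sum `Σ_{ij} ⟨ij|W|ij⟩` (on-site `i = j` terms included).
[cite: SzaboOstlund1996, §3.2.3 Eqs. (3.61)–(3.63)] -/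
def coulombSum (A : Matrix X I ℂ) (W : Matrix X X ℂ) : ℂ := ∑ i, ∑ j, twoBody A W i j i j

/-- Total exchange sum `Σ_{ij} ⟨ij|W|ji⟩`. [cite: SzaboOstlund1996, §3.2.3 Eq. (3.64)] -/
def exchangeSum (A : Matrix X I ℂ) (W : Matrix X X ℂ) : ℂ := ∑ i, ∑ j, twoBody A W i j j i

/-- Sum of the ON-SITE (intra-orbital) integrals `Σᵢ Uᵢ = Σᵢ ⟨ii|W|ii⟩` — the Edmiston–Ruedenberg
self-repulsion functional, maximised by "maximally interacting" orbitals. [cite: MiyakeAryasetiawan2008,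
§IV («unitary transformation so that U is maximized»)]; [cite: EdmistonRuedenberg1963, §II] -/
def onsiteSum (A : Matrix X I ℂ) (W : Matrix X X ℂ) : ℂ := ∑ i, twoBody A W i i i i

/-- Sum of the INTER-orbital density–density integrals `Σ_{i ≠ j} V_{ij} = Σ_{i≠j} ⟨ij|W|ij⟩`.
[cite: EdmistonRuedenberg1963, §II] -/
def offsiteSum (A : Matrix X I ℂ) (W : Matrix X X ℂ) : ℂ :=
  ∑ i, ∑ j ∈ Finset.univ.erase i, twoBody A W i j i j

omit [DecidableEq I] in
/-- The Coulomb sum is a functional of the density matrix alone: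
`Σ_{ij} ⟨ij|W|ij⟩ = Σ_{r r'} P(r,r) W(r,r') P(r',r')`. [cite: SzaboOstlund1996, §3.2.3 Eqs. (3.61)–(3.63)] -/
theorem coulombSum_eq (A : Matrix X I ℂ) (W : Matrix X X ℂ) :
    coulombSum A W = ∑ r, ∑ r', densityMatrix A r r * W r r' * densityMatrix A r' r' := by
  unfold coulombSum twoBody
  rw [sum4_comm]
  simp only [densityMatrix_apply, Finset.sum_mul, Finset.mul_sum]
  refine Finset.sum_congr rfl fun r _ => Finset.sum_congr rfl fun r' _ => ?_
  refine Finset.sum_comm.trans ?_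
  refine Finset.sum_congr rfl fun j _ => Finset.sum_congr rfl fun i _ => ?_
  ring

omit [DecidableEq I] in
/-- The exchange sum is a functional of the density matrix alone:
`Σ_{ij} ⟨ij|W|ji⟩ = Σ_{r r'} P(r',r) P(r,r') W(r,r')`. [cite: SzaboOstlund1996, §3.2.3 Eq. (3.64)] -/
theorem exchangeSum_eq (A : Matrix X I ℂ) (W : Matrix X X ℂ) :
    exchangeSum A W = ∑ r, ∑ r', densityMatrix A r' r * densityMatrix A r r' * W r r' := by
  unfold exchangeSum twoBody
  rw [sum4_comm]
  simp only [densityMatrix_apply, Finset.sum_mul, Finset.mul_sum]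
  refine Finset.sum_congr rfl fun r _ => Finset.sum_congr rfl fun r' _ => ?_
  refine Finset.sum_comm.trans ?_
  refine Finset.sum_congr rfl fun j _ => Finset.sum_congr rfl fun i _ => ?_
  ring

/-- **Gauge invariance of the Coulomb sum**: `Σ_{ij} ⟨ij|W|ij⟩` is unchanged under `A ↦ A V`,
`V Vᴴ = 1`. [cite: SzaboOstlund1996, §3.2.3 Eqs. (3.61)–(3.63)]; [cite: EdmistonRuedenberg1963, §II] -/
theorem coulombSum_gauge (A : Matrix X I ℂ) (W : Matrix X X ℂ) {V : Matrix I I ℂ}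
    (hV : V * Vᴴ = 1) : coulombSum (A * V) W = coulombSum A W := by
  rw [coulombSum_eq, coulombSum_eq, densityMatrix_mul_of_unitary A hV]

/-- **Gauge invariance of the exchange sum**: `Σ_{ij} ⟨ij|W|ji⟩` is unchanged under `A ↦ A V`,
`V Vᴴ = 1`. [cite: SzaboOstlund1996, §3.2.3 Eq. (3.64)]; [cite: EdmistonRuedenberg1963, §II] -/
theorem exchangeSum_gauge (A : Matrix X I ℂ) (W : Matrix X X ℂ) {V : Matrix I I ℂ}
    (hV : V * Vᴴ = 1) : exchangeSum (A * V) W = exchangeSum A W := by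
  rw [exchangeSum_eq, exchangeSum_eq, densityMatrix_mul_of_unitary A hV]

/-- The Coulomb sum splits into the on-site (Edmiston–Ruedenberg) part and the inter-orbital part:
`Σ_{ij} U_{ijij} = Σᵢ Uᵢ + Σ_{i≠j} V_{ij}`. [cite: EdmistonRuedenberg1963, §II] -/
theorem coulombSum_eq_onsite_add_offsite (A : Matrix X I ℂ) (W : Matrix X X ℂ) :
    coulombSum A W = onsiteSum A W + offsiteSum A W := by
  unfold coulombSum onsiteSum offsiteSum
  rw [← Finset.sum_add_distrib]
  refine Finset.sum_congr rfl fun i _ => ?_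
  rw [← Finset.add_sum_erase Finset.univ _ (Finset.mem_univ i)]

/-- **What the on-site `U` gains, the inter-site `V` loses**: under any gauge change `A ↦ A V`
(`V Vᴴ = 1`) the sum `Σᵢ Uᵢ + Σ_{i≠j} V_{ij}` is conserved, so maximising the on-site sum (maximal
"interaction localisation") is the same as minimising the inter-orbital density–density sum.
[cite: EdmistonRuedenberg1963, §II]; [cite: MiyakeAryasetiawan2008, §IV] -/
theorem onsite_add_offsite_gauge (A : Matrix X I ℂ) (W : Matrix X X ℂ) {V : Matrix I I ℂ}
    (hV : V * Vᴴ = 1) :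
    onsiteSum (A * V) W + offsiteSum (A * V) W = onsiteSum A W + offsiteSum A W := by
  rw [← coulombSum_eq_onsite_add_offsite, ← coulombSum_eq_onsite_add_offsite, coulombSum_gauge A W hV]

/-- Equivalently, the CHANGE of the on-site sum is minus the change of the inter-site sum.
[cite: EdmistonRuedenberg1963, §II] -/
theorem onsiteSum_sub_eq_neg (A : Matrix X I ℂ) (W : Matrix X X ℂ) {V : Matrix I I ℂ}
    (hV : V * Vᴴ = 1) :
    onsiteSum (A * V) W - onsiteSum A W = -(offsiteSum (A * V) W - offsiteSum A W) := by
  have h := onsite_add_offsite_gauge A W hV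
  linear_combination h

end WannierGauge

end Literature.MathematicalPhysics.QuantumLattice

end
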